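import Summits.QuantumFields.YangMills.Theses.ContractibleFibre
import Summits.QuantumFields.YangMills.Theorems.ContractibleFibreFibreToTorusDLRLimit
import Summits.QuantumFields.YangMills.Theorems.ContractibleFibreFibreToTorusLocalDLR
import Summits.QuantumFields.YangMills.Theorems.ContractibleFibreFibreToTorusChart
import Summits.QuantumFields.YangMills.Theorems.ContractibleFibreFibreToTorusTubeChart

/-!
# `stub_tubeLimitState`: free-tube thermodynamic limit ⇒ time-clustering DLR state

Stub (T) of crux `FibreToTorus` (stmt-QuantumFields-16244), line `uniqueness` (= `birth`'s
`stub_tubeThermodynamicLimit` verbatim), route `ContractibleFibre`.  If the free tubes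
`(ℤ/L)² × Fin(M+1)²` of EVERY width `M` cluster exponentially in Euclidean time at rate `m` with
slab-width constants `C(w)` uniform in `M` (on all `L ≥ L_min(w, M)`), then some DLR state
`μ ∈ ymGibbsMeasures r.ρ β` of the Wilson specification on `ℤ⁴` clusters in time at the SAME
rate `m` on all bounded measurable gauge-invariant cylinder observables.

Proof: diagonal tube sequence `M_k = k`, `L_k ≥ k + 1` above all floors `L_min(w, k)`, `w ≤ k`;
the tube Gibbs measures, read on `ℤ⁴` through the centred chart (`…TubeChart`), satisfy the
local DLR identities of `ymSpecification` for all large `k` (`…Chart`, `…LocalDLR`); a weak limit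
point exists (Prokhorov on the compact metrisable configuration space) and is a DLR state on which
the tube expectations of bounded measurable cylinder observables converge (`…DLRLimit`); the tube
clustering bound at slab width `w = 2R₀` (`R₀` = time-radius of the supports) passes to the
limit.
-/

noncomputable section

open scoped BigOperators Topology
open Filter Function MeasureTheory Finset
open Literature.MathematicalPhysics.QuantumFieldTheory (haarProbability LatticeRep IsCompactSimpleLieGroup
  YMSpecies)
open Literature.Probability.LatticeModels (Site glueWith)
open Literature.MathematicalPhysics.QuantumLattice (LGConfig ZdEdge configShift configShift_apply
  IsCylinder LocalGaugeObservable ymGibbsMeasures ymSpecification plaquettesTouching plaquetteEdges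
  wilsonBoundaryAction exists_bound_of_continuous integrable_of_bound measurable_glueWith_prod
  continuous_wilsonBoundaryAction integral_ymSpecification infiniteVolumeLimitPoints)

namespace Summit.QuantumFields.YangMills.Theorems.FibreToTorus

/-- Integration against a tilted measure as a ratio of weighted integrals:
`∫ g d(ν.tilted f) = (∫ g e^f dν) / (∫ e^f dν)`. [folklore] -/
theorem integral_tilted_eq_div {X : Type*} [MeasurableSpace X] (ν : Measure X) (f g : X → ℝ) :
    ∫ x, g x ∂(ν.tilted f) = (∫ x, g x * Real.exp (f x) ∂ν) / ∫ x, Real.exp (f x) ∂ν := by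
  rw [integral_tilted, ← integral_div]
  refine integral_congr_ae (ae_of_all _ fun x => ?_)
  simp only [smul_eq_mul]
  ring

/-- The product of a gauge-invariant local observable with a translate of another is a bounded
measurable cylinder observable. [folklore] -/
theorem prodShift_cylinder {G : Type} [Group G] [MeasurableSpace G] (A B : LocalGaugeObservable 4 G)
    (v : Site 4) :
    Measurable (fun U : LGConfig 4 G => A.F U * B.F (configShift v U)) ∧
      IsCylinder (fun U : LGConfig 4 G => A.F U * B.F (configShift v U))
        (A.supp ∪ B.supp.image fun e => (e.1 - v, e.2)) ∧
      IsCylinder (fun U : LGConfig 4 G => B.F (configShift v U))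
        (B.supp.image fun e => (e.1 - v, e.2)) := by
  have hB : IsCylinder (fun U : LGConfig 4 G => B.F (configShift v U))
      (B.supp.image fun e => (e.1 - v, e.2)) := by
    intro U V h
    refine B.isCylinder fun e he => ?_
    simp only [configShift_apply]
    exact h _ (mem_coe.2 (mem_image_of_mem (fun e : ZdEdge 4 => (e.1 - v, e.2)) (mem_coe.1 he)))
  refine ⟨A.measurable.mul (B.measurable.comp (configShift v).measurable), ?_, hB⟩
  intro U V h
  have h1 : A.F U = A.F V :=
    A.isCylinder fun e he => h e (mem_coe.2 (mem_union_left _ (mem_coe.1 he)))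
  have h2 : B.F (configShift v U) = B.F (configShift v V) :=
    hB fun e he => h e (mem_coe.2 (mem_union_right _ (mem_coe.1 he)))
  show A.F U * B.F (configShift v U) = A.F V * B.F (configShift v V)
  rw [h1, h2]

/-- Kernel averages of bounded measurable observables are measurable in the boundary condition
(the un-normalised kernel integrals are parametric product-Haar integrals of jointly measurable
integrands). [folklore] -/
theorem measurable_integral_ymSpecification {d N : ℕ} {G : Type*} [Group G] [TopologicalSpace G]
    [IsTopologicalGroup G] [CompactSpace G] [MeasurableSpace G] [BorelSpace G]
    [SecondCountableTopology G] (ρ : G →* Matrix (Fin N) (Fin N) ℂ) (hρ : Continuous ρ) (β : ℝ)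
    (Λ : Finset (ZdEdge d)) {F : LGConfig d G → ℝ} (hFm : Measurable F) :
    Measurable fun η => ∫ U, F U ∂(ymSpecification ρ β Λ η) := by
  have hw : Continuous fun U : LGConfig d G => Real.exp (-β * wilsonBoundaryAction ρ Λ U) :=
    Real.continuous_exp.comp (continuous_const.mul (continuous_wilsonBoundaryAction ρ hρ Λ))
  have hΦ : Measurable fun p : LGConfig d G × (↥Λ → G) =>
      F (glueWith Λ p.2 p.1) * Real.exp (-β * wilsonBoundaryAction ρ Λ (glueWith Λ p.2 p.1)) :=
    (hFm.comp (measurable_glueWith_prod Λ)).mul (hw.measurable.comp (measurable_glueWith_prod Λ))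
  have hΨ : Measurable fun p : LGConfig d G × (↥Λ → G) =>
      Real.exp (-β * wilsonBoundaryAction ρ Λ (glueWith Λ p.2 p.1)) :=
    hw.measurable.comp (measurable_glueWith_prod Λ)
  have h1 : Measurable fun η : LGConfig d G => ∫ ζ, F (glueWith Λ ζ η) *
      Real.exp (-β * wilsonBoundaryAction ρ Λ (glueWith Λ ζ η))
        ∂(Measure.pi fun _ : ↥Λ => haarProbability G) :=
    (hΦ.stronglyMeasurable.integral_prod_right').measurable
  have h2 : Measurable fun η : LGConfig d G => ∫ ζ,
      Real.exp (-β * wilsonBoundaryAction ρ Λ (glueWith Λ ζ η))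
        ∂(Measure.pi fun _ : ↥Λ => haarProbability G) :=
    (hΨ.stronglyMeasurable.integral_prod_right').measurable
  simp only [integral_ymSpecification ρ hρ β Λ hFm]
  exact h1.div h2

/-- Values of differences of small integers in `ZMod L`: for `|t| ≤ R₀ < L/2`,
`(t - (-R₀) mod L).val = t + R₀ ≤ 2R₀`. [folklore] -/
theorem zmod_val_sub_neg_le {L R₀ : ℕ} [NeZero L] {t : ℤ} (ht : t.natAbs ≤ R₀)
    (hL : 2 * R₀ + 1 ≤ L) :
    (((t : ℤ) : ZMod L) - (((-(R₀ : ℤ)) : ℤ) : ZMod L)).val ≤ 2 * R₀ := by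
  rw [← Int.cast_sub]
  have h0 : (0 : ℤ) ≤ t - -(R₀ : ℤ) := by omega
  have h1 : t - -(R₀ : ℤ) < (L : ℤ) := by omega
  have h2 := ZMod.val_intCast (n := L) (t - -(R₀ : ℤ))
  rw [Int.emod_eq_of_lt h0 h1] at h2
  omega

/-- Registered stub `stub_tubeLimitState` of crux `FibreToTorus` (line `uniqueness`; verbatim
`birth`'s `stub_tubeThermodynamicLimit`): the `M`-uniform free-tube family at `(β, m)` yields a
DLR state on `ℤ⁴` clustering in time at rate `m` on all gauge-invariant local observables. -/
theorem stub_tubeLimitState :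
    ∀ (G : Type) [Group G] [TopologicalSpace G] [IsTopologicalGroup G] [CompactSpace G]
      [MeasurableSpace G] [BorelSpace G], IsCompactSimpleLieGroup G → ∀ r : LatticeRep G,
      let Tube := fun (M : ℕ) (β m C : ℝ) (w Lmin : ℕ) => ∀ (L : ℕ) [NeZero L], Lmin ≤ L →
        let St := ZMod L × ZMod L × Fin (M + 1) × Fin (M + 1);
        let Cfg := St × Fin 4 → G;
        let ν : MeasureTheory.Measure Cfg := MeasureTheory.Measure.pi fun _ => haarProbability G;
        let sh : St → Fin 4 → St := fun x μ => ![(x.1 + 1, x.2.1, x.2.2.1, x.2.2.2), (x.1, x.2.1 + 1, x.2.2.1, x.2.2.2), (x.1, x.2.1, x.2.2.1 + 1, x.2.2.2), (x.1, x.2.1, x.2.2.1, x.2.2.2 + 1)] μ;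
        let ins : St → Fin 4 → Fin 4 → ℝ := fun x μ κ => if ((μ = 2 ∨ κ = 2) → (x.2.2.1 : ℕ) < M) ∧ ((μ = 3 ∨ κ = 3) → (x.2.2.2 : ℕ) < M) then 1 else 0;
        let pl : Cfg → St → Fin 4 → Fin 4 → G := fun U x μ κ => U (x, μ) * U (sh x μ, κ) * (U (sh x κ, μ))⁻¹ * (U (x, κ))⁻¹;
        let act : Cfg → ℝ := fun U => β * ∑ x : St, ∑ q : {q : Fin 4 × Fin 4 // q.1 < q.2}, ins x q.1.1 q.1.2 * (r.ρ (pl U x q.1.1 q.1.2)).trace.re;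
        let wgt : Cfg → ℝ := fun U => Real.exp (act U);
        let Ex : (Cfg → ℝ) → ℝ := fun F => (∫ U, F U * wgt U ∂ν) / (∫ U, wgt U ∂ν);
        let σ : ℕ → Cfg → Cfg := fun n U p => U ((p.1.1 + n, p.1.2), p.2);
        ∀ c : ZMod L,
        let Loc := fun F : Cfg → ℝ => Measurable F ∧ (∀ U, |F U| ≤ 1) ∧ ∀ U U', (∀ p : St × Fin 4, (p.1.1 - c).val ≤ w → U p = U' p) → F U = F U';
        ∀ F₁ F₂ : Cfg → ℝ, Loc F₁ → Loc F₂ → ∀ n : ℕ, 2 * n < L → |Ex (fun U => F₁ U * F₂ (σ n U)) - Ex F₁ * Ex (fun U => F₂ (σ n U))| ≤ C * Real.exp (-(m * n));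
      ∀ (β m : ℝ), 0 < m → (∀ w : ℕ, ∃ C : ℝ, ∀ M : ℕ, ∃ Lmin : ℕ, Tube M β m C w Lmin) →
        ∃ μ : MeasureTheory.Measure (LGConfig 4 G), μ ∈ ymGibbsMeasures (d := 4) r.ρ β ∧
          ∀ A B : YMSpecies G, ∃ C : ℝ, ∀ n : ℕ,
            |(∫ U, A.F U * B.F (configShift (-Pi.single 0 (n : ℤ)) U) ∂μ) -
                (∫ U, A.F U ∂μ) * (∫ U, B.F (configShift (-Pi.single 0 (n : ℤ)) U) ∂μ)| ≤
              C * Real.exp (-(m * n)) := by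
  intro G _ _ _ _ _ _ hG r
  dsimp only
  intro β m hm hfam
  classical
  -- `G` is Hausdorff and second countable through the faithful matrix representation `r`
  haveI : T2Space G := (r.continuous.isClosedEmbedding r.injective).isEmbedding.t2Space
  haveI : SecondCountableTopology G :=
    (r.continuous.isClosedEmbedding r.injective).isEmbedding.secondCountableTopology
  have hρ : Continuous r.ρ := r.continuous
  -- the constants and floors of the tube family
  choose C hC using hfam
  choose Lmin hT using hC
  -- the diagonal tube sequence: width `k`, length `Lk k`
  let Lk : ℕ → ℕ := fun k => (k + 1) + ∑ w ∈ Finset.range (k + 1), Lmin w k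
  have hLk_ge : ∀ k, k + 1 ≤ Lk k := fun k => Nat.le_add_right _ _
  have hLk_floor : ∀ w k, w ≤ k → Lmin w k ≤ Lk k := fun w k hwk =>
    le_add_left ((single_le_sum (f := fun w => Lmin w k) (fun _ _ => Nat.zero_le _)
      (mem_range.2 (Nat.lt_succ_of_le hwk))))
  haveI hLk_pos : ∀ k, NeZero (Lk k) := fun k => ⟨by have := hLk_ge k; omega⟩
  -- tube vocabulary at level `k` (width `M = k`, length `L = Lk k`)
  let St : ℕ → Type := fun k => ZMod (Lk k) × ZMod (Lk k) × Fin (k + 1) × Fin (k + 1)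
  let sh : (k : ℕ) → St k → Fin 4 → St k := fun k x μ =>
    ![(x.1 + 1, x.2.1, x.2.2.1, x.2.2.2), (x.1, x.2.1 + 1, x.2.2.1, x.2.2.2),
      (x.1, x.2.1, x.2.2.1 + 1, x.2.2.2), (x.1, x.2.1, x.2.2.1, x.2.2.2 + 1)] μ
  let ins : (k : ℕ) → St k → Fin 4 → Fin 4 → ℝ := fun k x μ κ =>
    if ((μ = 2 ∨ κ = 2) → (x.2.2.1 : ℕ) < k) ∧ ((μ = 3 ∨ κ = 3) → (x.2.2.2 : ℕ) < k) then 1 else 0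
  let act : (k : ℕ) → (St k × Fin 4 → G) → ℝ := fun k U =>
    β * ∑ x : St k, ∑ q : {q : Fin 4 × Fin 4 // q.1 < q.2}, ins k x q.1.1 q.1.2 *
      (r.ρ (U (x, q.1.1) * U (sh k x q.1.1, q.1.2) * (U (sh k x q.1.2, q.1.1))⁻¹ *
        (U (x, q.1.2))⁻¹)).trace.re
  let fM : (k : ℕ) → ℤ → Fin (k + 1) := fun k z =>
    ⟨min (z + ((k / 2 : ℕ) : ℤ)).toNat k, Nat.lt_succ_of_le (min_le_right _ _)⟩
  let ψ : (k : ℕ) → Site 4 → St k := fun k x =>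
    (((x 0 : ℤ) : ZMod (Lk k)), ((x 1 : ℤ) : ZMod (Lk k)), fM k (x 2), fM k (x 3))
  let π : (k : ℕ) → ZdEdge 4 → St k × Fin 4 := fun k e => (ψ k e.1, e.2)
  let ν : (k : ℕ) → Measure (St k × Fin 4 → G) := fun k =>
    Measure.pi fun _ => haarProbability G
  let τ : (k : ℕ) → Measure (St k × Fin 4 → G) := fun k => (ν k).tilted (act k)
  let P : ℕ → Measure (LGConfig 4 G) := fun k => (τ k).map fun V => V ∘ π k
  let σ : (k : ℕ) → ℕ → (St k × Fin 4 → G) → (St k × Fin 4 → G) := fun k n U p =>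
    U ((p.1.1 + n, p.1.2), p.2)
  -- the tube weights are bounded continuous, the tube states are probability measures
  have hact_cont : ∀ k, Continuous (act k) := fun k => by
    refine continuous_const.mul (continuous_finsetSum _ fun x _ =>
      continuous_finsetSum _ fun q _ => continuous_const.mul
        (Complex.continuous_re.comp (Continuous.matrix_trace (hρ.comp ?_))))
    fun_prop
  have hν_prob : ∀ k, IsProbabilityMeasure (ν k) := fun k => by
    simp only [ν]; infer_instance
  have hτ_prob : ∀ k, IsProbabilityMeasure (τ k) := fun k => by
    obtain ⟨Bd, hBd⟩ := exists_bound_of_continuous (Real.continuous_exp.comp (hact_cont k))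
    exact isProbabilityMeasure_tilted (integrable_of_bound
      (Real.continuous_exp.comp (hact_cont k)).aestronglyMeasurable hBd)
  have hπ_meas : ∀ k, Measurable fun V : St k × Fin 4 → G => (V ∘ π k : LGConfig 4 G) :=
    fun k => measurable_comp_chart (π k)
  haveI hP_prob : ∀ k, IsProbabilityMeasure (P k) := fun k =>
    Measure.isProbabilityMeasure_map (hπ_meas k).aemeasurable
  -- integrals against the tube states
  have hP_int : ∀ k (F : LGConfig 4 G → ℝ), Measurable F →
      ∫ U, F U ∂(P k) = (∫ V, F (V ∘ π k) * Real.exp (act k V) ∂(ν k)) /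
        ∫ V, Real.exp (act k V) ∂(ν k) := by
    intro k F hF
    simp only [P, τ]
    rw [integral_map (hπ_meas k).aemeasurable hF.aestronglyMeasurable, integral_tilted_eq_div]
  -- Euclidean time shifts on the tube are charted time translations
  have hshift : ∀ k (n : ℕ) (V : St k × Fin 4 → G),
      (σ k n V ∘ π k : LGConfig 4 G) = configShift (-Pi.single 0 (n : ℤ)) (V ∘ π k) := by
    intro k n V
    funext e
    simp [σ, π, ψ, configShift_apply, sub_neg_eq_add, Pi.add_apply, Int.cast_add, Int.cast_natCast]
  -- the local DLR identities hold on the tubes for all large `k`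
  have hlocal : ∀ (Λ S₀ : Finset (ZdEdge 4)) (F : LGConfig 4 G → ℝ), Measurable F →
      IsCylinder F S₀ → ∀ Cb : ℝ, (∀ U, |F U| ≤ Cb) → ∀ᶠ k in atTop,
        ∫ U, F U ∂(P k) = ∫ η, (∫ U, F U ∂(ymSpecification r.ρ β Λ η)) ∂(P k) := by
    intro Λ S₀ F hFm hFS Cb hCb
    set Bs : Finset (Site 4) :=
      (Λ ∪ S₀ ∪ (plaquettesTouching Λ).biUnion plaquetteEdges).image Prod.fst with hBs
    set R : ℕ := Bs.sup fun x => Finset.univ.sup fun i => (x i).natAbs with hR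
    have hRB : ∀ x ∈ Bs, ∀ i, (x i).natAbs ≤ R := fun x hx i =>
      (Finset.le_sup (f := fun i => (x i).natAbs) (Finset.mem_univ i)).trans
        (Finset.le_sup (f := fun x => Finset.univ.sup fun i => (x i).natAbs) hx)
    filter_upwards [eventually_ge_atTop (2 * R + 4)] with k hk
    have hkL : 2 * R + 1 ≤ Lk k := by have := hLk_ge k; omega
    obtain ⟨hinjψ, hstep, hpred, hins⟩ := tubeChart_good k (Lk k) R Bs hRB hk hkL
    obtain ⟨hinjπ, a, b, c, hac, hbc, ha, hb, hsplit⟩ :=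
      chart_action_split (sh k) (ψ k) Bs (ins k) r.ρ hρ β hinjψ hstep hpred hins Λ S₀
        Finset.Subset.rfl
    have hsplit' : ∀ V, act k V = a V + b V := hsplit
    have hγm : Measurable fun η : LGConfig 4 G => ∫ U, F U ∂(ymSpecification r.ρ β Λ η) :=
      measurable_integral_ymSpecification r.ρ hρ β Λ hFm
    rw [hP_int k F hFm, hP_int k _ hγm]
    have e1 : (fun V : St k × Fin 4 → G => F (V ∘ π k) * Real.exp (act k V)) =
        fun V => Real.exp (a V + b V) * F (V ∘ π k) := by
      funext V; rw [hsplit' V]; ring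
    have e2 : (fun V : St k × Fin 4 → G =>
        (∫ U, F U ∂(ymSpecification r.ρ β Λ (V ∘ π k))) * Real.exp (act k V)) =
        fun V => Real.exp (a V + b V) * ∫ U, F U ∂(ymSpecification r.ρ β Λ (V ∘ π k)) := by
      funext V; rw [hsplit' V]; ring
    rw [e1, e2, integral_weight_comp_chart_eq_condAvg r.ρ (π k) hρ β Λ S₀ hinjπ hac hbc ha hb
      hFm hCb hFS]
  -- a weak limit point of the tube states (Prokhorov on the compact metrisable configuration space)
  let Pm : ℕ → ProbabilityMeasure (LGConfig 4 G) := fun k => ⟨P k, hP_prob k⟩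
  obtain ⟨μp, -, φ, hφ, hlimφ⟩ :=
    (isCompact_univ (X := ProbabilityMeasure (LGConfig 4 G))).tendsto_subseq
      fun k => Set.mem_univ (Pm k)
  have hlimF : ∀ F : LGConfig 4 G → ℝ, Continuous F → (∃ Cb, ∀ U, |F U| ≤ Cb) →
      Tendsto (fun k => ∫ U, F U ∂(P (φ k))) atTop (𝓝 (∫ U, F U ∂(μp : Measure (LGConfig 4 G)))) := by
    intro F hFc hFb
    obtain ⟨Cb, hCb⟩ := hFb
    let Fb : BoundedContinuousFunction (LGConfig 4 G) ℝ :=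
      BoundedContinuousFunction.ofNormedAddCommGroup F hFc Cb
        (fun U => by simpa [Real.norm_eq_abs] using hCb U)
    exact (ProbabilityMeasure.tendsto_iff_forall_integral_tendsto.1 hlimφ) Fb
  obtain ⟨hGibbs, hconv⟩ := mem_ymGibbsMeasures_of_tendsto_of_localDLR (d := 4) r.ρ hρ β
    (fun k => P (φ k)) (μp : Measure (LGConfig 4 G)) hlimF
    (fun Λ S₀ F hFm hFS Cb hCb => hφ.tendsto_atTop.eventually (hlocal Λ S₀ F hFm hFS Cb hCb))
  refine ⟨(μp : Measure (LGConfig 4 G)), hGibbs, fun A B => ?_⟩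
  -- clustering: the `M`-uniform tube bound passes to the limit
  obtain ⟨a₀, ha₀⟩ := A.bounded
  obtain ⟨b₀, hb₀⟩ := B.bounded
  set a : ℝ := max a₀ 1 with ha_def
  set b : ℝ := max b₀ 1 with hb_def
  have ha_pos : 0 < a := lt_of_lt_of_le one_pos (le_max_right _ _)
  have hb_pos : 0 < b := lt_of_lt_of_le one_pos (le_max_right _ _)
  have haA : ∀ U, |A.F U| ≤ a := fun U => (ha₀ U).trans (le_max_left _ _)
  have hbB : ∀ U, |B.F U| ≤ b := fun U => (hb₀ U).trans (le_max_left _ _)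
  -- time radius of the supports and the slab width
  set R₀ : ℕ := (A.supp ∪ B.supp).sup fun e => (e.1 0).natAbs with hR₀_def
  have hR₀ : ∀ e ∈ A.supp ∪ B.supp, (e.1 0).natAbs ≤ R₀ := fun e he =>
    Finset.le_sup (f := fun e : ZdEdge 4 => (e.1 0).natAbs) he
  set w : ℕ := 2 * R₀ with hw_def
  refine ⟨a * b * C w, fun n => ?_⟩
  obtain ⟨hABm, hABcyl, hBncyl⟩ := prodShift_cylinder A B (-Pi.single 0 (n : ℤ))
  have hBnm : Measurable fun U : LGConfig 4 G => B.F (configShift (-Pi.single 0 (n : ℤ)) U) :=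
    B.measurable.comp (configShift _).measurable
  have hX := hconv _ _ hABm hABcyl (a * b) (fun U => by
    rw [abs_mul]; exact mul_le_mul (haA _) (hbB _) (abs_nonneg _) ((abs_nonneg _).trans (haA U)))
  have hY := hconv _ _ A.measurable A.isCylinder a haA
  have hZ := hconv _ _ hBnm hBncyl b (fun U => hbB _)
  -- the tube bound along the subsequence, for all large `k`
  have hbound : ∀ᶠ k in atTop,
      |(∫ U, A.F U * B.F (configShift (-Pi.single 0 (n : ℤ)) U) ∂(P (φ k))) -
          (∫ U, A.F U ∂(P (φ k))) *
            (∫ U, B.F (configShift (-Pi.single 0 (n : ℤ)) U) ∂(P (φ k)))| ≤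
        a * b * C w * Real.exp (-(m * n)) := by
    filter_upwards [hφ.tendsto_atTop.eventually (eventually_ge_atTop (max w (2 * n)))] with k hk
    set k' := φ k with hk'
    have hwk : w ≤ k' := (le_max_left _ _).trans hk
    have hnk : 2 * n < Lk k' := by
      have h1 := hLk_ge k'; have h2 := (le_max_right _ _).trans hk; omega
    have hLw : 2 * R₀ + 1 ≤ Lk k' := by have h1 := hLk_ge k'; omega
    -- the normalised charted observables are slab-local of width `w` at time `-R₀`
    set cc : ZMod (Lk k') := (((-(R₀ : ℤ)) : ℤ) : ZMod (Lk k')) with hcc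
    set F₁ : (St k' × Fin 4 → G) → ℝ := fun V => A.F (V ∘ π k') / a with hF₁
    set F₂ : (St k' × Fin 4 → G) → ℝ := fun V => B.F (V ∘ π k') / b with hF₂
    have hloc : ∀ (X : LocalGaugeObservable 4 G) (x : ℝ), 0 < x → (∀ U, |X.F U| ≤ x) →
        X.supp ⊆ A.supp ∪ B.supp →
        Measurable (fun V : St k' × Fin 4 → G => X.F (V ∘ π k') / x) ∧
          (∀ V, |X.F (V ∘ π k') / x| ≤ 1) ∧
          ∀ V V' : St k' × Fin 4 → G, (∀ p : St k' × Fin 4, (p.1.1 - cc).val ≤ w → V p = V' p) →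
            X.F (V ∘ π k') / x = X.F (V' ∘ π k') / x := by
      intro X x hx hXx hsupp
      refine ⟨(X.measurable.comp (hπ_meas k')).div_const x, fun V => ?_, fun V V' hVV' => ?_⟩
      · rw [abs_div, abs_of_pos hx, div_le_one hx]; exact hXx _
      · congr 1
        refine X.isCylinder fun e he => ?_
        simp only [Function.comp_apply]
        refine hVV' (π k' e) ?_
        have heR : (e.1 0).natAbs ≤ R₀ := hR₀ e (hsupp (mem_coe.1 he))
        exact zmod_val_sub_neg_le heR hLw
    have hL1 := hloc A a ha_pos haA subset_union_left
    have hL2 := hloc B b hb_pos hbB subset_union_right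
    -- the tube clustering bound at level `k'`
    have key : |(∫ V, F₁ V * F₂ (σ k' n V) * Real.exp (act k' V) ∂(ν k')) /
          (∫ V, Real.exp (act k' V) ∂(ν k')) -
        (∫ V, F₁ V * Real.exp (act k' V) ∂(ν k')) / (∫ V, Real.exp (act k' V) ∂(ν k')) *
          ((∫ V, F₂ (σ k' n V) * Real.exp (act k' V) ∂(ν k')) /
            (∫ V, Real.exp (act k' V) ∂(ν k')))| ≤ C w * Real.exp (-(m * n)) :=
      hT w k' (Lk k') (hLk_floor w k' hwk) cc F₁ F₂ hL1 hL2 n hnk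
    -- identification of the three tube expectations with integrals against `P k'`
    have i1 : (∫ V, F₁ V * F₂ (σ k' n V) * Real.exp (act k' V) ∂(ν k')) /
        (∫ V, Real.exp (act k' V) ∂(ν k')) =
        (∫ U, A.F U * B.F (configShift (-Pi.single 0 (n : ℤ)) U) ∂(P k')) / (a * b) := by
      rw [hP_int k' _ hABm, div_right_comm, ← integral_div (a * b)]
      congr 1
      refine integral_congr_ae (ae_of_all _ fun V => ?_)
      simp only [hF₁, hF₂]
      rw [hshift k' n V]
      ring
    have i2 : (∫ V, F₁ V * Real.exp (act k' V) ∂(ν k')) / (∫ V, Real.exp (act k' V) ∂(ν k')) =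
        (∫ U, A.F U ∂(P k')) / a := by
      rw [hP_int k' _ A.measurable, div_right_comm, ← integral_div a]
      congr 1
      refine integral_congr_ae (ae_of_all _ fun V => ?_)
      simp only [hF₁]
      ring
    have i3 : (∫ V, F₂ (σ k' n V) * Real.exp (act k' V) ∂(ν k')) /
        (∫ V, Real.exp (act k' V) ∂(ν k')) =
        (∫ U, B.F (configShift (-Pi.single 0 (n : ℤ)) U) ∂(P k')) / b := by
      rw [hP_int k' _ hBnm, div_right_comm, ← integral_div b]
      congr 1
      refine integral_congr_ae (ae_of_all _ fun V => ?_)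
      simp only [hF₂]
      rw [hshift k' n V]
      ring
    rw [i1, i2, i3] at key
    have hab : 0 < a * b := mul_pos ha_pos hb_pos
    have ha0 : a ≠ 0 := ha_pos.ne'
    have hb0 : b ≠ 0 := hb_pos.ne'
    have key' := mul_le_mul_of_nonneg_left key (abs_nonneg (a * b))
    rw [← abs_mul, abs_of_pos hab] at key'
    have halg : a * b * ((∫ U, A.F U * B.F (configShift (-Pi.single 0 (n : ℤ)) U) ∂(P k')) / (a * b) -
        (∫ U, A.F U ∂(P k')) / a * ((∫ U, B.F (configShift (-Pi.single 0 (n : ℤ)) U) ∂(P k')) / b)) =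
        (∫ U, A.F U * B.F (configShift (-Pi.single 0 (n : ℤ)) U) ∂(P k')) -
          (∫ U, A.F U ∂(P k')) * (∫ U, B.F (configShift (-Pi.single 0 (n : ℤ)) U) ∂(P k')) := by
      field_simp
    rw [halg] at key'
    calc _ ≤ a * b * (C w * Real.exp (-(m * n))) := key'
      _ = a * b * C w * Real.exp (-(m * n)) := by ring
  -- pass to the limit along the subsequence
  have hlim : Tendsto (fun k => |(∫ U, A.F U * B.F (configShift (-Pi.single 0 (n : ℤ)) U) ∂(P (φ k))) -
      (∫ U, A.F U ∂(P (φ k))) * (∫ U, B.F (configShift (-Pi.single 0 (n : ℤ)) U) ∂(P (φ k)))|)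
      atTop (𝓝 |(∫ U, A.F U * B.F (configShift (-Pi.single 0 (n : ℤ)) U) ∂(μp : Measure (LGConfig 4 G))) -
        (∫ U, A.F U ∂(μp : Measure (LGConfig 4 G))) *
          (∫ U, B.F (configShift (-Pi.single 0 (n : ℤ)) U) ∂(μp : Measure (LGConfig 4 G)))|) :=
    (hX.sub (hY.mul hZ)).abs
  exact le_of_tendsto hlim hbound

end Summit.QuantumFields.YangMills.Theorems.FibreToTorus

end
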